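import Summits.HubbardSuperconductivity.HubbardSuperconductivity.Theorems.BalabanIRBirComplexStableXYRULETreeIntegral
import Summits.HubbardSuperconductivity.HubbardSuperconductivity.Theorems.BalabanIRBirComplexStableXYFixedVolumeLattice
import Summits.HubbardSuperconductivity.HubbardSuperconductivity.Theorems.BirComplexStableXY.Negative.WitnessTable
import HarnessLib

/-!
# Uniform local equipartition, part 2: the sharp UPPER bound on the modulus partition function

Support file for crux `BirComplexStableXYR` (stmt-HubbardSuperconductivity-14845), line
`log-concave-core-bounded-phase`, stub `stub_uniformEquipartition` (line lead a2).

For a window table whose generating function satisfies the coercivity hypothesis (C) of the restated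
engine (`c₀·ΣΣ(1 − cos(φ_w − φ_w')) ≤ Re F(φ)`, `c₀ > 0`, window side `r ≥ 2`), every `κ > 0` and
every torus `Λ = (ℤ/L)² × ℤ/M`:

  `ule_partZ_upper`:  `∫_{[0,2π]^Λ} exp(−κ Σ_s Re F(θ∘sh s)) dθ ≤ 2π · (√(π³/(2κc₀)))^{|Λ| − 1}`.

Coercivity gives the nearest-neighbour XY energy along the three unit steps
(`birLat_coercive_compare`), which dominates the energy of an explicit rooted spanning tree of the
torus (parent = one step back in `t`, then `x₂`, then `x₁`; rank `x₁ + x₂ + t`); the tree integral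
factorises (`ule_tree_integral`) into one-bond factors `≤ √(π³/(2κc₀))` (`ule_bondIntegral_le`).
This is the half of the uniform local equipartition bound that carries the correct power
`κ^{-(|Λ|-1)/2}`.  `ule_partZ_upperBound` is the binder-free registered form. [folklore]
-/

noncomputable section

namespace Summit.HubbardSuperconductivity.HubbardSuperconductivity.Theorems

open MeasureTheory Set

/-! ### Upper bound for coercive window models: `Z(κ) ≤ 2π·(√(π³/(2κc₀)))^{|Λ|-1}` -/

section Upper

open Summit.HubbardSuperconductivity.BirComplexStableXYNegative Literature.Probability.LatticeModels

variable {r : ℕ}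

/-- The cube measure is the product of `|Λ|` copies of Lebesgue on `[0,2π]`. [folklore] -/
theorem ule_restrict_cube_eq_pi (L M : ℕ) [NeZero L] [NeZero M] :
    (volume : Measure (Λ L M → ℝ)).restrict (cube L M) =
      Measure.pi (fun _ : Λ L M => volume.restrict (Icc (0:ℝ) (2 * Real.pi))) := by
  rw [cube, volume_pi, Measure.restrict_pi_pi]

/-- **Sharp upper bound on the modulus partition function of a coercive window model.**  If
`c₀·ΣΣ(1 − cos(φ_w − φ_w')) ≤ Re F(φ)` for all window configurations (`c₀ > 0`, `r ≥ 2`), then for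
every `κ > 0` and every torus,
`∫_cube exp(−κ Σ_s Re F(θ∘sh s)) dθ ≤ 2π·(√(π³/(2κc₀)))^{|Λ|−1}`:
coercivity gives the nearest-neighbour XY energy (`birLat_coercive_compare`), which dominates the
energy of a spanning tree, whose integral factorises (`ule_tree_integral`) into one-bond factors
`≤ √(π³/(2κc₀))` (`ule_bondIntegral_le`). [folklore] -/
theorem ule_partZ_upper (hr : 2 ≤ r) (c : Table r) {c₀ : ℝ} (hc₀ : 0 < c₀)
    (hC : ∀ φ : W r → ℝ, c₀ * ∑ w, ∑ w', (1 - Real.cos (φ w - φ w')) ≤ (genF c φ).re)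
    {κ : ℝ} (hκ : 0 < κ) (L M : ℕ) [NeZero L] [NeZero M] :
    ∫ θ in cube L M, Real.exp (-(κ * ∑ s : Λ L M, (genF c (fun w => θ (sh L M s w))).re)) ≤
      2 * Real.pi * (Real.sqrt (Real.pi ^ 3 / (2 * (κ * c₀)))) ^ (Fintype.card (Λ L M) - 1) := by
  classical
  -- the three unit steps and the spanning tree
  set E : Fin 3 → Λ L M := ![((![1, 0] : TorusSite 2 L), (0 : ZMod M)), (![0, 1], 0), (0, 1)] with hE
  let dir : Λ L M → Fin 3 := fun a => if a.2 ≠ 0 then 2 else if a.1 1 ≠ 0 then 1 else 0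
  let par : Λ L M → Λ L M := fun a => if a ≠ 0 then a - E (dir a) else a
  let rk : Λ L M → ℕ := fun a => (a.1 0).val + (a.1 1).val + a.2.val
  have hroot : rk 0 = 0 := by simp [rk]
  have hE0 : E 0 = (![1, 0], 0) := by simp [hE]
  have hE1 : E 1 = (![0, 1], 0) := by simp [hE]
  have hE2 : E 2 = (0, 1) := by simp [hE]
  -- rank decrease along the parent map
  have hval1L : ∀ z : ZMod L, z ≠ 0 → (z - 1).val + 1 = z.val := by
    intro z hz
    have hzv : 1 ≤ z.val := Nat.one_le_iff_ne_zero.mpr ((ZMod.val_ne_zero z).mpr hz)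
    have hL2 : 2 ≤ L := by
      rcases Nat.lt_or_ge L 2 with h | h
      · interval_cases L
        · exact absurd rfl (NeZero.ne (0 : ℕ))
        · exact absurd (Subsingleton.elim z 0) hz
      · exact h
    haveI : Fact (1 < L) := ⟨hL2⟩
    have h1 : (1 : ZMod L).val = 1 := ZMod.val_one L
    rw [ZMod.val_sub (by rw [h1]; exact hzv), h1]
    omega
  have hval1M : ∀ z : ZMod M, z ≠ 0 → (z - 1).val + 1 = z.val := by
    intro z hz
    have hzv : 1 ≤ z.val := Nat.one_le_iff_ne_zero.mpr ((ZMod.val_ne_zero z).mpr hz)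
    have hM2 : 2 ≤ M := by
      rcases Nat.lt_or_ge M 2 with h | h
      · interval_cases M
        · exact absurd rfl (NeZero.ne (0 : ℕ))
        · exact absurd (Subsingleton.elim z 0) hz
      · exact h
    haveI : Fact (1 < M) := ⟨hM2⟩
    have h1 : (1 : ZMod M).val = 1 := ZMod.val_one M
    rw [ZMod.val_sub (by rw [h1]; exact hzv), h1]
    omega
  have hpar : ∀ a, a ≠ 0 → rk (par a) < rk a := by
    intro a ha
    simp only [par, if_pos ha]
    by_cases h2 : a.2 ≠ 0
    · have hd : dir a = 2 := by simp [dir, h2]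
      rw [hd, hE2]
      simp only [rk, Prod.fst_sub, Prod.snd_sub, sub_zero]
      have := hval1M a.2 h2
      omega
    · push Not at h2
      by_cases h1 : a.1 1 ≠ 0
      · have hd : dir a = 1 := by simp [dir, h2, h1]
        rw [hd, hE1]
        simp only [rk, Prod.fst_sub, Prod.snd_sub, sub_zero, Pi.sub_apply, Matrix.cons_val_zero,
          Matrix.cons_val_one]
        have := hval1L (a.1 1) h1
        omega
      · push Not at h1
        have h0 : a.1 0 ≠ 0 := by
          intro h0
          apply ha
          refine Prod.ext ?_ h2
          funext i
          fin_cases i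
          · exact h0
          · exact h1
        have hd : dir a = 0 := by simp [dir, h2, h1]
        rw [hd, hE0]
        simp only [rk, Prod.fst_sub, Prod.snd_sub, sub_zero, Pi.sub_apply, Matrix.cons_val_zero,
          Matrix.cons_val_one]
        have := hval1L (a.1 0) h0
        omega
  have hpar_add : ∀ a, a ≠ 0 → par a + E (dir a) = a := by
    intro a ha; simp only [par, if_pos ha, sub_add_cancel]
  -- the one-bond factor
  set g : ℝ → ℝ := fun t => Real.exp (-((κ * c₀) * (1 - Real.cos t))) with hg
  have hgmeas : Measurable g := by
    have : Continuous g := Real.continuous_exp.comp (by fun_prop)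
    exact this.measurable
  have hgper : Function.Periodic g (2 * Real.pi) := fun t => by simp [hg, Real.cos_add_two_pi]
  have hgnn : ∀ t, 0 ≤ g t := fun t => (Real.exp_pos _).le
  have hgle : ∀ t, g t ≤ 1 := fun t => by
    simp only [hg]
    apply Real.exp_le_one_iff.mpr
    have : 0 ≤ 1 - Real.cos t := sub_nonneg.2 (Real.cos_le_one t)
    nlinarith [mul_pos hκ hc₀]
  -- pointwise domination of the weight by the tree product
  have hdom : ∀ θ : Λ L M → ℝ,
      Real.exp (-(κ * ∑ s : Λ L M, (genF c (fun w => θ (sh L M s w))).re)) ≤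
        ∏ a ∈ Finset.univ.erase (0 : Λ L M), g (θ a - θ (par a)) := by
    intro θ
    -- (a) coercivity ⇒ nearest-neighbour energy (landed comparison lemma)
    have hnn := birLat_coercive_compare (L := L) (M := M) hr (F := genF c) hC (sh := sh L M)
      (fun s w => rfl) hc₀.le θ
    rw [← Complex.re_sum]
    -- (b) tree energy ≤ nearest-neighbour energy
    set f : Λ L M × Fin 3 → ℝ := fun q => 1 - Real.cos (θ q.1 - θ (q.1 + E q.2)) with hf
    have hf0 : ∀ q, 0 ≤ f q := fun q => sub_nonneg.2 (Real.cos_le_one _)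
    have htree : ∑ a ∈ Finset.univ.erase (0 : Λ L M), (1 - Real.cos (θ a - θ (par a))) ≤
        ∑ q : Λ L M × Fin 3, f q := by
      have hinj : Set.InjOn (fun a => (par a, dir a)) (Finset.univ.erase (0 : Λ L M) : Set (Λ L M)) := by
        intro a ha b hb hab
        simp only [Finset.coe_erase, Set.mem_sdiff, Set.mem_singleton_iff, Finset.coe_univ,
          Set.mem_univ, true_and] at ha hb
        obtain ⟨h1, h2⟩ := Prod.mk.inj hab
        rw [← hpar_add a ha, ← hpar_add b hb, h1, h2]
      have heq : ∑ a ∈ Finset.univ.erase (0 : Λ L M), (1 - Real.cos (θ a - θ (par a))) =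
          ∑ q ∈ (Finset.univ.erase (0 : Λ L M)).image (fun a => (par a, dir a)), f q := by
        rw [Finset.sum_image hinj]
        refine Finset.sum_congr rfl fun a ha => ?_
        have ha' : a ≠ 0 := (Finset.mem_erase.1 ha).1
        simp only [hf]
        conv_rhs => rw [hpar_add a ha']
        rw [← Real.cos_neg, neg_sub]
      rw [heq]
      exact Finset.sum_le_sum_of_subset_of_nonneg (Finset.subset_univ _) fun q _ _ => hf0 q
    have hnn_sum : ∑ q : Λ L M × Fin 3, f q =
        ∑ s : Λ L M, ((1 - Real.cos (θ s - θ (s + (![1, 0], 0)))) +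
          (1 - Real.cos (θ s - θ (s + (![0, 1], 0)))) + (1 - Real.cos (θ s - θ (s + (0, 1))))) := by
      rw [Fintype.sum_prod_type]
      refine Finset.sum_congr rfl fun s _ => ?_
      simp only [hf, Fin.sum_univ_three, hE0, hE1, hE2]
    -- (c) assemble the exponent inequality
    have hH : (κ * c₀) * ∑ a ∈ Finset.univ.erase (0 : Λ L M), (1 - Real.cos (θ a - θ (par a))) ≤
        κ * (∑ s : Λ L M, genF c (fun w => θ (sh L M s w))).re := by
      rw [← hnn_sum] at hnn
      have h2 := mul_le_mul_of_nonneg_left htree hc₀.le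
      have h3 := mul_le_mul_of_nonneg_left (h2.trans hnn) hκ.le
      linarith [h3]
    -- (d) exponentiate
    have hprod : ∏ a ∈ Finset.univ.erase (0 : Λ L M), g (θ a - θ (par a)) =
        Real.exp (-((κ * c₀) * ∑ a ∈ Finset.univ.erase (0 : Λ L M), (1 - Real.cos (θ a - θ (par a))))) := by
      rw [Finset.mul_sum, ← Finset.sum_neg_distrib, Real.exp_sum]
    rw [hprod]
    exact Real.exp_le_exp.mpr (by linarith)
  -- integrate and factorise
  have hint_rhs : Integrable (fun θ : Λ L M → ℝ => ∏ a ∈ Finset.univ.erase (0 : Λ L M), g (θ a - θ (par a)))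
      ((volume : Measure (Λ L M → ℝ)).restrict (cube L M)) := by
    rw [ule_restrict_cube_eq_pi]
    refine (integrable_const (1:ℝ)).mono' ?_ (ae_of_all _ fun θ => ?_)
    · refine (Finset.measurable_prod _ fun a _ => ?_).aestronglyMeasurable
      exact hgmeas.comp ((measurable_pi_apply a).sub (measurable_pi_apply _))
    · rw [Real.norm_eq_abs, abs_of_nonneg (Finset.prod_nonneg fun a _ => hgnn _)]
      exact Finset.prod_le_one (fun a _ => hgnn _) fun a _ => hgle _
  calc ∫ θ in cube L M, Real.exp (-(κ * ∑ s : Λ L M, (genF c (fun w => θ (sh L M s w))).re))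
      ≤ ∫ θ in cube L M, ∏ a ∈ Finset.univ.erase (0 : Λ L M), g (θ a - θ (par a)) := by
        refine integral_mono_of_nonneg (ae_of_all _ fun θ => (Real.exp_pos _).le) hint_rhs
          (ae_of_all _ hdom)
    _ = 2 * Real.pi * (∫ t in Icc (0:ℝ) (2 * Real.pi), g t) ^ (Fintype.card (Λ L M) - 1) := by
        rw [ule_restrict_cube_eq_pi]
        exact ule_tree_integral g hgmeas hgper hgnn hgle (0 : Λ L M) par rk hpar hroot
    _ ≤ 2 * Real.pi * (Real.sqrt (Real.pi ^ 3 / (2 * (κ * c₀)))) ^ (Fintype.card (Λ L M) - 1) := by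
        have hI := ule_bondIntegral_le (mul_pos hκ hc₀)
        have hI0 : 0 ≤ ∫ t in Icc (0:ℝ) (2 * Real.pi), g t := integral_nonneg fun t => hgnn t
        gcongr

end Upper

section UpperStub

open Summit.HubbardSuperconductivity.BirComplexStableXYNegative Literature.Probability.LatticeModels

/-- **Registered form of `ule_partZ_upper`** (binder-free, for the crux stub registry). [folklore] -/
theorem ule_partZ_upperBound :
    ∀ (r : ℕ), 2 ≤ r → ∀ (c : Table r) (c₀ : ℝ), 0 < c₀ → (∀ φ : W r → ℝ, c₀ * ∑ w, ∑ w', (1 - Real.cos (φ w - φ w')) ≤ (genF c φ).re) → ∀ (κ : ℝ), 0 < κ → ∀ (L M : ℕ) [NeZero L] [NeZero M], ∫ θ in cube L M, Real.exp (-(κ * ∑ s : Λ L M, (genF c (fun w => θ (sh L M s w))).re)) ≤ 2 * Real.pi * (Real.sqrt (Real.pi ^ 3 / (2 * (κ * c₀)))) ^ (Fintype.card (Λ L M) - 1) :=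
  fun _ hr c _ hc₀ hC _ hκ L M _ _ => ule_partZ_upper hr c hc₀ hC hκ L M

end UpperStub

end Summit.HubbardSuperconductivity.HubbardSuperconductivity.Theorems

end
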